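import Summits.BirchSwinnertonDyer.BirchSwinnertonDyer.Theses.TameQuarticManinParity
import Literature.NumberTheory.EllipticCurves.NeronIsogenyScaling
import HarnessLib

/-!
# Route `TameQuarticManinParity`, LINE 25 (bsd-idea-3 g8), glue GM25 `TprimeIrrTwistPairManinDivisibilityOfSandwich`
# (stmt-BirchSwinnertonDyer-22746) — PROVED BY NAME: sandwich S25 ∧ twisted Néron lattice law T24L ⟹ the twist-pair
# Manin divisibilities M25 `c_{III*} ∣ c_{III} ∣ 3·c_{III*}`

Cell `pub/bsd-wall`, D-0145 line `route-BirchSwinnertonDyer-TeichmullerTwistDescent`, seat `bsd-line-ttd-p1` g10,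
working the planner-of-record's TQMP LINE 25 (proof = the planner's sketch `ideas/l25/Sketch25.lean`, re-checked). BSD is
NOT proved by this; Manin's conjecture is not proved by this; S25 (`TprimeTwistLatticeSandwich`, 22692), T24L
(`TprimeIrrOptimalTwistNeronLattice`, 22694) and M25 (`TprimeIrrTwistPairManinDivisibility`, 22695) are the hypotheses /
conclusion of the glue and are not proved here.

## Statement (verbatim the route decl)

`TprimeTwistLatticeSandwich → TprimeIrrOptimalTwistNeronLattice → TprimeIrrTwistPairManinDivisibility`.

## Proof

With `G = g(χ)`, exactness `Λ(W) = c·Λ(f)`, `Λ(A) = c'·Λ(f_χ)` and T24L (`z ∈ Λ(A) ↔ G z ∈ Λ(W)`): S25(1) gives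
`(c/c')·Λ(A) ⊆ Λ(A)`, S25(2) gives `(3c'/c)·Λ(W) ⊆ Λ(W)`; the elementary same-lattice integrality
`int_of_rat_mul_mem_lattice_self` (`NeronIsogenyScaling`, a tree theorem) makes both scalars integers; `c, c' ≠ 0`
by `ModularParametrizationData.maninConstant_ne_zero_holds`. Design: theorems only; no definition, no named fact, no
`sorry`; axioms `propext`, `Classical.choice`, `Quot.sound`.
-/

set_option autoImplicit false
-- D-0017: single-problem summit, so `Summit.BirchSwinnertonDyer.BirchSwinnertonDyer.…` repeats a namespace BY DESIGN.
set_option linter.dupNamespace false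

noncomputable section

open scoped Classical

namespace Summit.BirchSwinnertonDyer.BirchSwinnertonDyer.Theorems.TameQuarticManinParity

open Literature.NumberTheory.EllipticCurves Literature.NumberTheory.EllipticCurves.ModularForms
  Summit.BirchSwinnertonDyer.BirchSwinnertonDyer.Theses.TameQuarticManinParity

/-- **Glue GM25 `TprimeIrrTwistPairManinDivisibilityOfSandwich`** (stmt-BirchSwinnertonDyer-22746), by name:
S25 ∧ T24L ⟹ M25 (`D'.c ∣ D.c ∧ D.c ∣ 3·D'.c` on an optimal (III, III*) twist pair), by lattice algebra.
[cite: Stevens1989, Lemmas (5.2), (5.4)] -/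
theorem tprimeIrrTwistPairManinDivisibilityOfSandwich_proof : TprimeIrrTwistPairManinDivisibilityOfSandwich := by
  unfold TprimeIrrTwistPairManinDivisibilityOfSandwich
  intro hS hT W _ _ _ hcm hadd ht hirr h3 D hex hmin h9 χ hχ hprim A _ _ D' hf hex' hmin'
  set G : ℂ := gaussSum χ (ZMod.stdAddChar (N := 3)) with hG
  obtain ⟨hS1, hS2⟩ := hS W hadd D h9 χ hχ hprim
  have hiff := hT W hcm hadd ht hirr h3 D hex hmin h9 χ hχ hprim A D' hf hex' hmin'
  have hc : D.c ≠ 0 := D.maninConstant_ne_zero_holds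
  have hc' : D'.c ≠ 0 := D'.maninConstant_ne_zero_holds
  have hcℂ : (D.c : ℂ) ≠ 0 := by exact_mod_cast hc
  have hc'ℂ : (D'.c : ℂ) ≠ 0 := by exact_mod_cast hc'
  have hcℚ : (D.c : ℚ) ≠ 0 := by exact_mod_cast hc
  have hc'ℚ : (D'.c : ℚ) ≠ 0 := by exact_mod_cast hc'
  refine ⟨?_, ?_⟩
  · -- `(c/c') Λ(A) ⊆ Λ(A)`, hence `c/c' ∈ ℤ`
    have key : ∀ z ∈ D'.L.lattice, ((((D.c : ℚ) / D'.c : ℚ)) : ℂ) * z ∈ D'.L.lattice := by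
      intro z hz
      obtain ⟨w, hw, rfl⟩ := hex' z hz
      rw [hf] at hw
      have h1 : (D.c : ℂ) * (G * w) ∈ D.L.lattice := D.smul_periodLattice_le _ (hS1 w hw)
      rw [hiff]
      convert h1 using 1
      push_cast
      field_simp
      rw [hG]; ring
    obtain ⟨k, hk⟩ := int_of_rat_mul_mem_lattice_self D'.L _ key
    refine ⟨k, ?_⟩
    have h' : (D.c : ℚ) = D'.c * k := by rw [hk]; field_simp
    exact_mod_cast h'
  · -- `(3c'/c) Λ(W) ⊆ Λ(W)`, hence `3c'/c ∈ ℤ`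
    have key : ∀ z ∈ D.L.lattice, ((((3 * D'.c : ℚ) / D.c : ℚ)) : ℂ) * z ∈ D.L.lattice := by
      intro z hz
      obtain ⟨w, hw, rfl⟩ := hex z hz
      obtain ⟨w', hw', h3w⟩ := hS2 w hw
      have hw'' : w' ∈ periodLattice D'.f := by
        rw [hf]; exact hw'
      have h1 : (D'.c : ℂ) * w' ∈ D'.L.lattice := D'.smul_periodLattice_le _ hw''
      have h2 : G * ((D'.c : ℂ) * w') ∈ D.L.lattice := (hiff _).mp h1
      have e : ((((3 * D'.c : ℚ) / D.c : ℚ)) : ℂ) * ((D.c : ℂ) * w) = (D'.c : ℂ) * (3 * w) := by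
        push_cast
        field_simp
      rw [e, h3w]
      convert h2 using 1
      ring
    obtain ⟨k, hk⟩ := int_of_rat_mul_mem_lattice_self D.L _ key
    refine ⟨k, ?_⟩
    have h' : (3 * D'.c : ℚ) = D.c * k := by rw [hk]; field_simp
    exact_mod_cast h'

end Summit.BirchSwinnertonDyer.BirchSwinnertonDyer.Theorems.TameQuarticManinParity

end
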